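import Mathlib
import Literature.Analysis.FluidPDE.TorusNSHelicityBalance
import Literature.Analysis.FluidPDE.TorusClassicalLerayHopfProofs
import Literature.Analysis.FunctionSpaces.TorusClassicalNSUniqueness
import Literature.Analysis.FluidPDE.TorusABCFlow
import Literature.Analysis.FluidPDE.TorusStrainVorticityIsometry
import Literature.Analysis.FunctionSpaces.TorusFluidGlueProofs
import HarnessLib

/-!
# Arnold's form for a Beltrami host on `T³`: exact conservation along classical Euler flows

HONEST FRAMING (cell `ns-blowup`, seat `ns-blowup-circuit` g2, human ruling D-0035): this cell ATTEMPTS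
the negative direction of the Clay problem; nothing in this file is a claim about Navier–Stokes
regularity or blow-up. WHAT THIS IS NOT: not an estimate and not a stability theorem for any
Navier–Stokes flow; it is the exact IDENTITY behind memo
`run/shared/lean/pub/ns-blowup/CIRCUIT-OBSTRUCTIONS.md` §H.5(a) / §I.3, discharged for the true Euler
equations on the unit torus (the abstract algebra is `ArnoldBeltramiForm.lean` in this directory).

Setting (the tree's orientation-free torus vocabulary, frame `e : d ≃ Fin 3`, `i⁺ = e⁻¹(e i + 1)`,
`i⁺⁺ = e⁻¹(e i + 2)`, `(curlₑ w)ᵢ = W_{i⁺ i⁺⁺}`, `W = torusVorticityTensor w`): the helicity pairing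
`Bₑ(v, w) = ∫ ∑ᵢ vᵢ (curlₑ w)ᵢ`, the helicity `Hₑ(v) = Bₑ(v, v)` (the functional of
`Torus.IsClassicalNSSolutionOn.helicity_eq_of_euler`), and a smooth BELTRAMI HOST `U`,
`curlₑ U = λ U`.

## What is typed (all inline, no definitions)
* `integral_sum_mul_torusVorticityTensor_comm` — `Bₑ(v, w) = Bₑ(w, v)` for smooth `v, w`
  (the curl is `L²`-symmetric on the torus; integration by parts — the tree proves this privately in
  `TorusNSHelicityBalance`, re-derived here for vector fields).
* `integral_sum_mul_torusVorticityTensor_of_beltrami` — `Bₑ(v, U) = λ ∫ ∑ᵢ vᵢ Uᵢ`.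
* `helicity_sub_beltrami` — `Hₑ(v − U) = Hₑ(v) − 2λ ∫∑ᵢ vᵢUᵢ + λ ∫∑ᵢ Uᵢ²`.
* `arnoldForm_sub_beltrami` — THE IDENTITY `Hₑ(v − U) − λ∫‖v − U‖² = Hₑ(v) − λ∫‖v‖²` for every smooth
  `v` (cross terms cancel exactly; no smallness, no linearisation).
* `arnoldForm_perturbation_eq_of_euler` (+ `_abcFlow`: the ABC hosts, `λ = 2π`, identity frame) —
  along a classical Euler solution `u` on `[a, b] × T³`
  (`ν = 0`, `f = 0`), `Hₑ(u t − U) − λ∫‖u t − U‖² = Hₑ(u a − U) − λ∫‖u a − U‖²` for all `t ∈ [a, b]`: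
  energy (`Torus.IsClassicalNSSolutionOn.energy_eq`) and helicity (`helicity_eq_of_euler`) conservation.
* `hasDerivWithinAt_arnoldForm_of_forced_beltrami` (appended) — the forced viscous balance, see below.
Sector reading (memo; `ArnoldBeltramiForm.perturbation_norm_sq_le`): `Hₑ − λ‖·‖² = Σ (σ|q| − λ)|v̂_{q,σ}|²`.
Honest limits: `U` is any smooth field with `curlₑ U = λU` (e.g. ABC, `λ = 2π`); classical solutions
on a closed interval; nothing is claimed about existence or about `t → ∞`.
-/

noncomputable section

open Set MeasureTheory Finset
open scoped InnerProductSpace RealInnerProductSpace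

namespace Summit.NavierStokesRegularity.FluidComputer.ArnoldBeltramiFormTorus

open Literature.Analysis.FunctionSpaces Literature.Analysis.FluidPDE

variable {d : Type*} [Fintype d] [DecidableEq d]

/-! ### Frame bookkeeping and integration by parts (copies of the tree's private tools in
`TorusNSHelicityBalance`, which are not exported) -/

omit [DecidableEq d] in
/-- Sums over `d` read through a frame `e : d ≃ Fin 3`. [folklore] -/
private theorem sum_eq_sum_fin_three (e : d ≃ Fin 3) (G : d → ℝ) :
    ∑ i, G i = ∑ a : Fin 3, G (e.symm a) :=
  Fintype.sum_equiv e _ _ fun i => by simp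

omit [Fintype d] [DecidableEq d] in
/-- Addition table of `Fin 3`. [folklore] -/
private theorem fin3_add :
    (0 : Fin 3) + 1 = 1 ∧ (0 : Fin 3) + 2 = 2 ∧ (1 : Fin 3) + 1 = 2 ∧ (1 : Fin 3) + 2 = 0 ∧
      (2 : Fin 3) + 1 = 0 ∧ (2 : Fin 3) + 2 = 1 := by
  decide

/-- Integration by parts for one partial derivative (smooth real functions). [folklore] -/
private theorem integral_mul_partialDeriv {α β : UnitAddTorus d → ℝ} (hα : Torus.IsSmooth α)
    (hβ : Torus.IsSmooth β) (k : d) :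
    ∫ x, α x * Torus.partialDeriv k β x = -∫ x, Torus.partialDeriv k α x * β x := by
  have hab : Torus.IsSmooth (fun y => α y * β y) := hα.mul hβ
  have h1 : Torus.IsSmooth (fun y => α y * Torus.partialDeriv k β y) := hα.mul (hβ.partialDeriv k)
  have h2 : Torus.IsSmooth (fun y => Torus.partialDeriv k α y * β y) := (hα.partialDeriv k).mul hβ
  have h0 : ∫ x, Torus.partialDeriv k (fun y => α y * β y) x = 0 :=
    Torus.integral_partialDeriv_eq_zero_holds hab k
  simp_rw [Torus.partialDeriv_mul (hα.isContDiff (by simp)) (hβ.isContDiff (by simp))] at h0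
  rw [integral_add h1.integrable h2.integrable] at h0
  linarith

/-- `∫ a · curlₑ b = ∫ curlₑ a · b` for smooth scalar families (copy of the tree's private
`Torus.integral_sum_mul_curl_eq`). [folklore] -/
private theorem integral_sum_mul_curl_eq (e : d ≃ Fin 3) {A B : d → UnitAddTorus d → ℝ}
    (hA : ∀ i, Torus.IsSmooth (A i)) (hB : ∀ i, Torus.IsSmooth (B i)) :
    ∫ x, ∑ i, A i x * (Torus.partialDeriv (e.symm (e i + 1)) (B (e.symm (e i + 2))) x -
        Torus.partialDeriv (e.symm (e i + 2)) (B (e.symm (e i + 1))) x) =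
      ∫ x, ∑ i, (Torus.partialDeriv (e.symm (e i + 1)) (A (e.symm (e i + 2))) x -
        Torus.partialDeriv (e.symm (e i + 2)) (A (e.symm (e i + 1))) x) * B i x := by
  set I : Fin 3 → Fin 3 → Fin 3 → ℝ := fun p q r =>
    ∫ x, Torus.partialDeriv (e.symm p) (A (e.symm q)) x * B (e.symm r) x with hI
  have hsm1 : ∀ i p q, Torus.IsSmooth (fun x => A i x * Torus.partialDeriv p (B q) x) :=
    fun i p q => (hA i).mul ((hB q).partialDeriv p)
  have hsm2 : ∀ i p q, Torus.IsSmooth (fun x => Torus.partialDeriv p (A q) x * B i x) :=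
    fun i p q => ((hA q).partialDeriv p).mul (hB i)
  have hL : ∀ i, Integrable (fun x => A i x * (Torus.partialDeriv (e.symm (e i + 1))
      (B (e.symm (e i + 2))) x - Torus.partialDeriv (e.symm (e i + 2)) (B (e.symm (e i + 1))) x)) := by
    intro i
    have := ((hsm1 i (e.symm (e i + 1)) (e.symm (e i + 2))).sub
      (hsm1 i (e.symm (e i + 2)) (e.symm (e i + 1)))).integrable
    refine this.congr (ae_of_all _ fun x => ?_)
    simp only [Pi.sub_apply]; ring
  have hR : ∀ i, Integrable (fun x => (Torus.partialDeriv (e.symm (e i + 1)) (A (e.symm (e i + 2))) x -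
      Torus.partialDeriv (e.symm (e i + 2)) (A (e.symm (e i + 1))) x) * B i x) := by
    intro i
    have := ((hsm2 i (e.symm (e i + 1)) (e.symm (e i + 2))).sub
      (hsm2 i (e.symm (e i + 2)) (e.symm (e i + 1)))).integrable
    refine this.congr (ae_of_all _ fun x => ?_)
    simp only [Pi.sub_apply]; ring
  rw [integral_finsetSum _ fun i _ => hL i, integral_finsetSum _ fun i _ => hR i]
  have hLi : ∀ i, ∫ x, A i x * (Torus.partialDeriv (e.symm (e i + 1)) (B (e.symm (e i + 2))) x -
      Torus.partialDeriv (e.symm (e i + 2)) (B (e.symm (e i + 1))) x) =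
      -I (e i + 1) (e i) (e i + 2) + I (e i + 2) (e i) (e i + 1) := by
    intro i
    simp_rw [mul_sub]
    rw [integral_sub (hsm1 i _ _).integrable (hsm1 i _ _).integrable,
      integral_mul_partialDeriv (hA i) (hB _), integral_mul_partialDeriv (hA i) (hB _), hI]
    simp only [Equiv.symm_apply_apply]
    ring
  have hRi : ∀ i, ∫ x, (Torus.partialDeriv (e.symm (e i + 1)) (A (e.symm (e i + 2))) x -
      Torus.partialDeriv (e.symm (e i + 2)) (A (e.symm (e i + 1))) x) * B i x =
      I (e i + 1) (e i + 2) (e i) - I (e i + 2) (e i + 1) (e i) := by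
    intro i
    simp_rw [sub_mul]
    rw [integral_sub (hsm2 i _ _).integrable (hsm2 i _ _).integrable, hI]
    simp only [Equiv.symm_apply_apply]
  simp_rw [hLi, hRi]
  rw [sum_eq_sum_fin_three e, sum_eq_sum_fin_three e]
  obtain ⟨h01, h02, h11, h12, h21, h22⟩ := fin3_add
  simp only [Equiv.apply_symm_apply, Fin.sum_univ_three, zero_add, h11, h12, h21, h22]
  ring

/-! ### The helicity pairing of vector fields -/

/-- The frame curl of a `C¹` vector field in scalar-family form:
`W_{i⁺ i⁺⁺}(w) = ∂_{i⁺} w_{i⁺⁺} − ∂_{i⁺⁺} w_{i⁺}` with the components as scalar functions. [folklore] -/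
theorem torusVorticityTensor_frame_eq (e : d ≃ Fin 3) {w : UnitAddTorus d → EuclideanSpace ℝ d}
    (hw : Torus.IsSmooth w) (i : d) (x : UnitAddTorus d) :
    torusVorticityTensor w (e.symm (e i + 1)) (e.symm (e i + 2)) x =
      Torus.partialDeriv (e.symm (e i + 1)) (fun y => w y (e.symm (e i + 2))) x -
        Torus.partialDeriv (e.symm (e i + 2)) (fun y => w y (e.symm (e i + 1))) x := by
  rw [torusVorticityTensor, Torus.partialDeriv_apply_coord (hw.isContDiff (by simp)),
    Torus.partialDeriv_apply_coord (hw.isContDiff (by simp))]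

/-- **The curl is `L²`-symmetric on `T³`**: `∫ ∑ᵢ vᵢ (curlₑ w)ᵢ = ∫ ∑ᵢ wᵢ (curlₑ v)ᵢ` for smooth
vector fields `v, w` (integration by parts, no boundary; Majda–Bertozzi 2002, proof of Prop. 1.12,
p. 29). [folklore] -/
theorem integral_sum_mul_torusVorticityTensor_comm (e : d ≃ Fin 3)
    {v w : UnitAddTorus d → EuclideanSpace ℝ d} (hv : Torus.IsSmooth v) (hw : Torus.IsSmooth w) :
    ∫ x, ∑ i, v x i * torusVorticityTensor w (e.symm (e i + 1)) (e.symm (e i + 2)) x =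
      ∫ x, ∑ i, w x i * torusVorticityTensor v (e.symm (e i + 1)) (e.symm (e i + 2)) x := by
  simp_rw [torusVorticityTensor_frame_eq e hw, torusVorticityTensor_frame_eq e hv]
  rw [integral_sum_mul_curl_eq e (A := fun i y => v y i) (B := fun i y => w y i)
    (fun i => hv.apply i) (fun i => hw.apply i)]
  refine integral_congr_ae (ae_of_all _ fun x => ?_)
  exact Finset.sum_congr rfl fun i _ => by ring


/-- The frame curl of a smooth field is a smooth scalar function. [folklore] -/
private theorem isSmooth_torusVorticityTensor {w : UnitAddTorus d → EuclideanSpace ℝ d}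
    (hw : Torus.IsSmooth w) (p q : d) : Torus.IsSmooth (torusVorticityTensor w p q) :=
  ((hw.partialDeriv p).apply q).sub ((hw.partialDeriv q).apply p)

/-- The helicity-pairing integrand of smooth fields is integrable. [folklore] -/
private theorem integrable_pairing (e : d ≃ Fin 3) {a b : UnitAddTorus d → EuclideanSpace ℝ d}
    (ha : Torus.IsSmooth a) (hb : Torus.IsSmooth b) :
    Integrable (fun x => ∑ i, a x i *
      torusVorticityTensor b (e.symm (e i + 1)) (e.symm (e i + 2)) x) := by
  refine integrable_finsetSum _ fun i _ => ?_
  have h : Torus.IsSmooth (fun y => a y i *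
      torusVorticityTensor b (e.symm (e i + 1)) (e.symm (e i + 2)) y) :=
    (ha.apply i).mul (isSmooth_torusVorticityTensor hb _ _)
  exact h.integrable

omit [DecidableEq d] in
/-- The product-of-components integrand of smooth fields is integrable. [folklore] -/
private theorem integrable_sum_mul {a b : UnitAddTorus d → EuclideanSpace ℝ d}
    (ha : Torus.IsSmooth a) (hb : Torus.IsSmooth b) :
    Integrable (fun x => ∑ i, a x i * b x i) := by
  refine integrable_finsetSum _ fun i _ => ?_
  have h : Torus.IsSmooth (fun y => a y i * b y i) := (ha.apply i).mul (hb.apply i)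
  exact h.integrable

/-- The vorticity tensor is additive: `W(v − U) = W(v) − W(U)` for `C¹` fields. [folklore] -/
theorem torusVorticityTensor_sub {v U : UnitAddTorus d → EuclideanSpace ℝ d}
    (hv : Torus.IsSmooth v) (hU : Torus.IsSmooth U) (p q : d) (x : UnitAddTorus d) :
    torusVorticityTensor (v - U) p q x = torusVorticityTensor v p q x - torusVorticityTensor U p q x := by
  simp only [torusVorticityTensor]
  rw [Torus.partialDeriv_sub (hv.isContDiff (by simp)) (hU.isContDiff (by simp)),
    Torus.partialDeriv_sub (hv.isContDiff (by simp)) (hU.isContDiff (by simp))]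
  simp only [Pi.sub_apply, PiLp.sub_apply]
  ring

/-- **Pairing against a Beltrami host**: if `curlₑ U = λU` then `∫ ∑ᵢ vᵢ (curlₑ U)ᵢ = λ ∫ ∑ᵢ vᵢ Uᵢ`.
[folklore] -/
theorem integral_sum_mul_torusVorticityTensor_of_beltrami (e : d ≃ Fin 3)
    (v : UnitAddTorus d → EuclideanSpace ℝ d) {U : UnitAddTorus d → EuclideanSpace ℝ d} {lam : ℝ}
    (hcurl : ∀ i x, torusVorticityTensor U (e.symm (e i + 1)) (e.symm (e i + 2)) x = lam * U x i) :
    ∫ x, ∑ i, v x i * torusVorticityTensor U (e.symm (e i + 1)) (e.symm (e i + 2)) x =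
      lam * ∫ x, ∑ i, v x i * U x i := by
  rw [← integral_const_mul]
  refine integral_congr_ae (ae_of_all _ fun x => ?_)
  dsimp only
  rw [Finset.mul_sum]
  exact Finset.sum_congr rfl fun i _ => by rw [hcurl]; ring

omit [DecidableEq d] in
/-- Real Euclidean inner product as a sum of products of components. [folklore] -/
private theorem inner_eq_sum_mul (a b : EuclideanSpace ℝ d) : ⟪a, b⟫_ℝ = ∑ i, a i * b i := by
  rw [PiLp.inner_apply]
  exact Finset.sum_congr rfl fun i _ => by simp [mul_comm]

/-- **Helicity of the perturbation of a Beltrami host**: for smooth `v` and a smooth host `U` with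
`curlₑ U = λU`, `Hₑ(v − U) = Hₑ(v) − 2λ ∫∑ᵢ vᵢUᵢ + λ ∫∑ᵢ UᵢUᵢ` (bilinearity, `L²`-symmetry of the curl,
and the Beltrami relation). [folklore] -/
theorem helicity_sub_beltrami (e : d ≃ Fin 3) {v U : UnitAddTorus d → EuclideanSpace ℝ d}
    (hv : Torus.IsSmooth v) (hU : Torus.IsSmooth U) {lam : ℝ}
    (hcurl : ∀ i x, torusVorticityTensor U (e.symm (e i + 1)) (e.symm (e i + 2)) x = lam * U x i) :
    ∫ x, ∑ i, (v - U) x i * torusVorticityTensor (v - U) (e.symm (e i + 1)) (e.symm (e i + 2)) x =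
      (∫ x, ∑ i, v x i * torusVorticityTensor v (e.symm (e i + 1)) (e.symm (e i + 2)) x) -
        2 * lam * (∫ x, ∑ i, v x i * U x i) + lam * ∫ x, ∑ i, U x i * U x i := by
  have hpt : ∀ x, ∑ i, (v - U) x i *
      torusVorticityTensor (v - U) (e.symm (e i + 1)) (e.symm (e i + 2)) x =
      (∑ i, v x i * torusVorticityTensor v (e.symm (e i + 1)) (e.symm (e i + 2)) x) -
        (∑ i, v x i * torusVorticityTensor U (e.symm (e i + 1)) (e.symm (e i + 2)) x) -
        (∑ i, U x i * torusVorticityTensor v (e.symm (e i + 1)) (e.symm (e i + 2)) x) +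
        ∑ i, U x i * torusVorticityTensor U (e.symm (e i + 1)) (e.symm (e i + 2)) x := by
    intro x
    rw [← Finset.sum_sub_distrib, ← Finset.sum_sub_distrib, ← Finset.sum_add_distrib]
    refine Finset.sum_congr rfl fun i _ => ?_
    rw [torusVorticityTensor_sub hv hU, Pi.sub_apply, PiLp.sub_apply]
    ring
  simp_rw [hpt]
  have hA := integrable_pairing e hv hv
  have hB := integrable_pairing e hv hU
  have hC := integrable_pairing e hU hv
  have hD := integrable_pairing e hU hU
  have hAB : Integrable (fun x =>
      (∑ i, v x i * torusVorticityTensor v (e.symm (e i + 1)) (e.symm (e i + 2)) x) -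
        ∑ i, v x i * torusVorticityTensor U (e.symm (e i + 1)) (e.symm (e i + 2)) x) := hA.sub hB
  have hABC : Integrable (fun x =>
      (∑ i, v x i * torusVorticityTensor v (e.symm (e i + 1)) (e.symm (e i + 2)) x) -
        (∑ i, v x i * torusVorticityTensor U (e.symm (e i + 1)) (e.symm (e i + 2)) x) -
        ∑ i, U x i * torusVorticityTensor v (e.symm (e i + 1)) (e.symm (e i + 2)) x) := hAB.sub hC
  rw [integral_add hABC hD, integral_sub hAB hC, integral_sub hA hB,
    integral_sum_mul_torusVorticityTensor_comm e hU hv,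
    integral_sum_mul_torusVorticityTensor_of_beltrami e v hcurl,
    integral_sum_mul_torusVorticityTensor_of_beltrami e U hcurl]
  ring

/-- **THE IDENTITY (memo H.5(a)) on `T³`**: for every smooth field `v` and smooth Beltrami host `U`
(`curlₑ U = λU`), `Hₑ(v − U) − λ∫‖v − U‖² = Hₑ(v) − λ∫‖v‖²` — the cross terms
`−2λ∫v·U + 2λ∫v·U` cancel exactly (no smallness, no linearisation). [folklore] -/
theorem arnoldForm_sub_beltrami (e : d ≃ Fin 3) {v U : UnitAddTorus d → EuclideanSpace ℝ d}
    (hv : Torus.IsSmooth v) (hU : Torus.IsSmooth U) {lam : ℝ}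
    (hcurl : ∀ i x, torusVorticityTensor U (e.symm (e i + 1)) (e.symm (e i + 2)) x = lam * U x i) :
    (∫ x, ∑ i, (v - U) x i * torusVorticityTensor (v - U) (e.symm (e i + 1)) (e.symm (e i + 2)) x) -
        lam * ∫ x, ‖v x - U x‖ ^ 2 =
      (∫ x, ∑ i, v x i * torusVorticityTensor v (e.symm (e i + 1)) (e.symm (e i + 2)) x) -
        lam * ∫ x, ‖v x‖ ^ 2 := by
  rw [helicity_sub_beltrami e hv hU hcurl]
  have hpt : ∀ x, ‖v x - U x‖ ^ 2 = ‖v x‖ ^ 2 - 2 * (∑ i, v x i * U x i) + ∑ i, U x i * U x i := by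
    intro x
    rw [norm_sub_sq_real, inner_eq_sum_mul, ← real_inner_self_eq_norm_sq (U x), inner_eq_sum_mul]
  simp_rw [hpt]
  have h1 : Integrable (fun x => ‖v x‖ ^ 2) := hv.norm_sq.integrable
  have h2 : Integrable (fun x => 2 * ∑ i, v x i * U x i) := (integrable_sum_mul hv hU).const_mul 2
  have h3 := integrable_sum_mul hU hU
  have h12 : Integrable (fun x => ‖v x‖ ^ 2 - 2 * ∑ i, v x i * U x i) := h1.sub h2
  rw [integral_add h12 h3, integral_sub h1 h2, integral_const_mul]
  ring

/-- **Exact conservation of Arnold's form along classical Euler flows on `T³`**: for a classical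
solution `u` of the Euler equations (`ν = 0`, `f = 0`) on `[a, b] × T^d`, `card d = 3`, and a smooth
Beltrami host `U` with `curlₑ U = λU` (e.g. an ABC flow, `λ = 2π`), the quantity
`Hₑ(u(t) − U) − λ ∫‖u(t) − U‖²` does not depend on `t ∈ [a, b]` — energy and helicity conservation
plus `arnoldForm_sub_beltrami`. This is the energy–Casimir (Arnold) second variation about a Beltrami
steady state, here as an EXACT nonlinear identity; its sector-wise definiteness (memo H.5(a)) is what
forbids homochiral super-modulus growth off such a host. [folklore] -/
theorem arnoldForm_perturbation_eq_of_euler (e : d ≃ Fin 3) {a b : ℝ} (hab : a < b)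
    {u : ℝ → UnitAddTorus d → EuclideanSpace ℝ d} {p : ℝ → UnitAddTorus d → ℝ}
    (h : Torus.IsClassicalNSSolutionOn (Icc a b) 0 0 u p)
    {U : UnitAddTorus d → EuclideanSpace ℝ d} (hU : Torus.IsSmooth U) {lam : ℝ}
    (hcurl : ∀ i x, torusVorticityTensor U (e.symm (e i + 1)) (e.symm (e i + 2)) x = lam * U x i)
    {t : ℝ} (ht : t ∈ Icc a b) :
    (∫ x, ∑ i, (u t - U) x i *
        torusVorticityTensor (u t - U) (e.symm (e i + 1)) (e.symm (e i + 2)) x) -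
        lam * ∫ x, ‖u t x - U x‖ ^ 2 =
      (∫ x, ∑ i, (u a - U) x i *
        torusVorticityTensor (u a - U) (e.symm (e i + 1)) (e.symm (e i + 2)) x) -
        lam * ∫ x, ‖u a x - U x‖ ^ 2 := by
  have hut : Torus.IsSmooth (u t) := h.smooth_velocity.isSmooth_slice ht
  have hua : Torus.IsSmooth (u a) := h.smooth_velocity.isSmooth_slice ⟨le_rfl, hab.le⟩
  rw [arnoldForm_sub_beltrami e hut hU hcurl, arnoldForm_sub_beltrami e hua hU hcurl,
    h.helicity_eq_of_euler e hab ht]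
  have hE := h.energy_eq (convex_Icc a b) ht.1 (Icc_subset_Icc le_rfl ht.2)
  simp only [zero_mul, add_zero, Pi.zero_apply, inner_zero_left, integral_zero,
    intervalIntegral.integral_zero, Torus.kineticEnergy] at hE
  have hE' : ∫ x, ‖u t x‖ ^ 2 = ∫ x, ‖u a x‖ ^ 2 := by linarith
  rw [hE']


/-- **The ABC hosts**: for every classical Euler solution `u` on `[a, b] × 𝕋³` and every ABC flow
`U = u_{ABC}` (`curl U = 2πU` on the unit torus, `Torus.torusVorticityTensor_abcFlow_frame`),
`H(u(t) − U) − 2π∫‖u(t) − U‖²` is constant on `[a, b]` (identity frame). This is the host of the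
cell's P-LADDER-3 / X0 lane; the statement is an exact Euler identity and says nothing about the
forced viscous problem studied there. [folklore] -/
theorem arnoldForm_perturbation_eq_of_euler_abcFlow (A B C : ℝ) {a b : ℝ} (hab : a < b)
    {u : ℝ → UnitAddTorus (Fin 3) → EuclideanSpace ℝ (Fin 3)} {p : ℝ → UnitAddTorus (Fin 3) → ℝ}
    (h : Torus.IsClassicalNSSolutionOn (Icc a b) 0 0 u p) {t : ℝ} (ht : t ∈ Icc a b) :
    (∫ x, ∑ i, (u t - Torus.abcFlow A B C) x i *
        torusVorticityTensor (u t - Torus.abcFlow A B C) ((Equiv.refl (Fin 3)).symm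
          ((Equiv.refl (Fin 3)) i + 1)) ((Equiv.refl (Fin 3)).symm ((Equiv.refl (Fin 3)) i + 2)) x) -
        2 * Real.pi * ∫ x, ‖u t x - Torus.abcFlow A B C x‖ ^ 2 =
      (∫ x, ∑ i, (u a - Torus.abcFlow A B C) x i *
        torusVorticityTensor (u a - Torus.abcFlow A B C) ((Equiv.refl (Fin 3)).symm
          ((Equiv.refl (Fin 3)) i + 1)) ((Equiv.refl (Fin 3)).symm ((Equiv.refl (Fin 3)) i + 2)) x) -
        2 * Real.pi * ∫ x, ‖u a x - Torus.abcFlow A B C x‖ ^ 2 :=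
  arnoldForm_perturbation_eq_of_euler (Equiv.refl (Fin 3)) hab h (Torus.isSmooth_abcFlow A B C)
    (Torus.torusVorticityTensor_abcFlow_frame A B C) ht


/-! ## The FORCED VISCOUS balance (appended 2026-08-25, circuit g2; memo §K.3): along classical NS with
the host-maintaining force `f = νλ²U` (the P-LADDER-3 / P-TOWER setting) the Arnold form of the FULL STATE
obeys `d/dt [Hₑ(u) − λ∫‖u‖²] = −2ν [∫ ω·curlₑ ω − λ ∫|ω|²]`; the force cancels exactly
(`2∫f·ω − 2λ∫f·u = 2νλ³∫U·u − 2νλ³∫U·u`). By `arnoldForm_sub_beltrami` the left side is also the derivative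
of `Hₑ(u − U) − λ∫‖u − U‖²`; the right side is `−2ν Q_λ(curlₑ u)`. Fully nonlinear, any amplitude. -/

/-- `‖∇u‖₂² = ∫ ∑ᵢ ωᵢ²` (frame form) for smooth divergence-free `u` on `T³`
(`integral_torusVorticitySqAt_eq_two_mul_torusEnstrophy` + `torusVorticitySqAt_eq_sum_sq_of_equiv`).
[folklore] -/
theorem gradNormSq_eq_integral_sum_vorticity_sq (e : d ≃ Fin 3)
    {u : UnitAddTorus d → EuclideanSpace ℝ d} (hu : Torus.IsSmooth u) (hdiv : Torus.IsDivFree u) :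
    Torus.gradNormSq u =
      ∫ x, ∑ i, torusVorticityTensor u (e.symm (e i + 1)) (e.symm (e i + 2)) x ^ 2 := by
  rw [gradNormSq_eq_two_mul_torusEnstrophy, ← integral_torusVorticitySqAt_eq_two_mul_torusEnstrophy hu hdiv]
  exact integral_congr_ae (ae_of_all _ fun x => torusVorticitySqAt_eq_sum_sq_of_equiv e u x)

/-- **The forced viscous Arnold balance.** For a classical Navier–Stokes solution `u` on `[a, b] × T^d`
(`card d = 3`) with viscosity `ν` and the steady force `f = νλ²U`, `U` a smooth Beltrami host
(`curlₑ U = λU`): `d/dt [Hₑ(u(t)) − λ ∫‖u(t)‖²] = −2ν [∫ ∑ᵢ ωᵢ (curlₑ ω)ᵢ − λ ∫ ∑ᵢ ωᵢ²]` within `[a, b]`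
(`ωᵢ = W_{i⁺ i⁺⁺}(u(t))`; the curl of `ω` written as in
`Torus.IsClassicalNSSolutionOn.hasDerivWithinAt_helicity'`). The force drops out identically. [folklore] -/
theorem hasDerivWithinAt_arnoldForm_of_forced_beltrami (e : d ≃ Fin 3) {a b ν lam : ℝ} (hab : a < b)
    {u : ℝ → UnitAddTorus d → EuclideanSpace ℝ d} {p : ℝ → UnitAddTorus d → ℝ}
    {U : UnitAddTorus d → EuclideanSpace ℝ d} (hU : Torus.IsSmooth U)
    (hcurl : ∀ i x, torusVorticityTensor U (e.symm (e i + 1)) (e.symm (e i + 2)) x = lam * U x i)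
    (h : Torus.IsClassicalNSSolutionOn (Icc a b) ν (fun _ x => (ν * lam ^ 2) • U x) u p)
    {t : ℝ} (ht : t ∈ Icc a b) :
    HasDerivWithinAt
      (fun s => (∫ x, ∑ i, u s x i * torusVorticityTensor (u s) (e.symm (e i + 1)) (e.symm (e i + 2)) x) -
        lam * ∫ x, ‖u s x‖ ^ 2)
      (-(2 * ν) * ((∫ x, ∑ i, torusVorticityTensor (u t) (e.symm (e i + 1)) (e.symm (e i + 2)) x *
          (Torus.partialDeriv (e.symm (e i + 1)) (torusVorticityTensor (u t)
              (e.symm (e (e.symm (e i + 2)) + 1)) (e.symm (e (e.symm (e i + 2)) + 2))) x -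
            Torus.partialDeriv (e.symm (e i + 2)) (torusVorticityTensor (u t)
              (e.symm (e (e.symm (e i + 1)) + 1)) (e.symm (e (e.symm (e i + 1)) + 2))) x)) -
        lam * ∫ x, ∑ i, torusVorticityTensor (u t) (e.symm (e i + 1)) (e.symm (e i + 2)) x ^ 2))
      (Icc a b) t := by
  have hut : Torus.IsSmooth (u t) := h.smooth_velocity.isSmooth_slice ht
  -- helicity and energy balances of the tree
  have hH := h.hasDerivWithinAt_helicity' e hab ht
  have hE := Torus.IsClassicalNSSolutionOn.energy_balance_holds h (convex_Icc a b) ht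
  -- `∫‖u s‖² = 2 · kineticEnergy (u s)`
  have hKE : (fun s => lam * ∫ x, ‖u s x‖ ^ 2) = fun s => (2 * lam) * Torus.kineticEnergy (u s) := by
    funext s; simp only [Torus.kineticEnergy]; ring
  have hE2 : HasDerivWithinAt (fun s => lam * ∫ x, ‖u s x‖ ^ 2)
      ((2 * lam) * (-ν * Torus.gradNormSq (u t) +
        ∫ x, ⟪(fun (_ : ℝ) (x : UnitAddTorus d) => (ν * lam ^ 2) • U x) t x, u t x⟫_ℝ)) (Icc a b) t := by
    rw [hKE]; exact hE.const_mul _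
  have hQ := hH.sub hE2
  refine hQ.congr_deriv ?_
  -- the two force integrals
  have hF1 : (∫ x, ∑ i, (fun (_ : ℝ) (x : UnitAddTorus d) => (ν * lam ^ 2) • U x) t x i *
      torusVorticityTensor (u t) (e.symm (e i + 1)) (e.symm (e i + 2)) x) =
      ν * lam ^ 2 * (lam * ∫ x, ∑ i, u t x i * U x i) := by
    rw [← integral_sum_mul_torusVorticityTensor_of_beltrami e (u t) hcurl,
      ← integral_sum_mul_torusVorticityTensor_comm e hU hut, ← integral_const_mul]
    refine integral_congr_ae (ae_of_all _ fun x => ?_)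
    dsimp only
    rw [Finset.mul_sum]
    exact Finset.sum_congr rfl fun i _ => by rw [PiLp.smul_apply, smul_eq_mul]; ring
  have hF2 : (∫ x, ⟪(fun (_ : ℝ) (x : UnitAddTorus d) => (ν * lam ^ 2) • U x) t x, u t x⟫_ℝ) =
      ν * lam ^ 2 * ∫ x, ∑ i, u t x i * U x i := by
    rw [← integral_const_mul]
    refine integral_congr_ae (ae_of_all _ fun x => ?_)
    dsimp only
    rw [inner_smul_left, inner_eq_sum_mul]
    simp only [conj_trivial]
    congr 1
    exact Finset.sum_congr rfl fun i _ => mul_comm _ _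
  rw [hF1, hF2, gradNormSq_eq_integral_sum_vorticity_sq e hut (h.divFree t ht)]
  ring

end Summit.NavierStokesRegularity.FluidComputer.ArnoldBeltramiFormTorus

end
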